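import Summits.Ventures.PercRepro.C026AcyclicPhi
import Summits.Ventures.PercRepro.C026GluingNEveryP
import Summits.Ventures.PercRepro.C026HubPair
import Summits.Ventures.PercRepro.C026GluingSigma

/-!
# C-026 at every `p` on multigraphs whose `{a, b, c}`-bridges are trees or hub-pair pieces (p6, gen 10)

Acyclic marked multigraphs are D-free (`Acyclic.dFreeIneq`, `C026AcyclicPhi.lean`) and acyclicity is
closed under marked minors (`Acyclic.minor`), so they form a FACE-CLOSED D-free family — the second one in
the tree after the hub-pair multigraphs (`dFreeIneq_of_hubPair`, `IsHubPairGraph.minor`).  The every-`p`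
composition theorem for any number of colour classes (`c026_of_gluingN_of_dFree_minors`,
`C026GluingNEveryP.lean`) then gives:

* **`c026_of_acyclicOrHubPair_bridges`** — C-026 at every `p ∈ [0,1]^E` on every marked multigraph with a
  colouring of its edges under which every non-mark is one-coloured (`IsGluingN`: the colour classes are
  unions of `{a, b, c}`-bridges) and every colour class is acyclic or a hub-pair multigraph;
* `c026_of_acyclic` — C-026 at every `p` on acyclic multigraphs (p5's `c026_forest`, re-derived through
  the D-free inequality);
* `c026_of_acyclicOrHubPair_sigma` — the side-by-side form (a family sharing only the marks, `sigmaGraph`).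
-/

namespace PercRepro

namespace MultiGraph

universe u

variable {V : Type*}

/-- **Marked minors of acyclic multigraphs are acyclic**: a closed free edge joined in the minor is a
closed edge joined in the embedded configuration of `G`. -/
theorem Acyclic.minor {E : Type*} {G : MultiGraph V E} (hG : G.Acyclic) (u v : Config E) :
    (G.minor u v).Acyclic := by
  intro ρ e he h
  have h' : G.Conn (embed u v ρ) (G.fst e.1) (G.snd e.1) := (G.conn_embed_iff u v ρ _ _).2 h
  have he' : embed u v ρ e.1 = false := by rw [embed_apply_of_mem u v ρ e.2]; exact he
  exact hG _ e.1 he' h'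

/-- **Acyclic multigraphs are face-closed D-free**: every marked minor satisfies the D-free inequality. -/
theorem Acyclic.dFreeIneq_minor {E : Type*} [Fintype E] [DecidableEq E] {G : MultiGraph V E}
    (hG : G.Acyclic) (a b c : V) (u v : Config E) :
    (G.minor u v).DFreeIneq (G.sureClass v a) (G.sureClass v b) (G.sureClass v c) :=
  (hG.minor u v).dFreeIneq _ _ _

/-- **C-026 at every `p` on acyclic multigraphs** (through the D-free inequality on every marked minor). -/
theorem c026_of_acyclic {E : Type*} [Fintype E] [DecidableEq E] {G : MultiGraph V E} (hG : G.Acyclic)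
    (a b c : V) (p : E → ℝ) (hp : IsProb p) :
    (G.law3 p a b c 0 + G.law3 p a b c 1) * (G.law3 p a b c 1 + G.law3 p a b c 4) ≤
      G.law3 p a b c 1 + G.law3 p a b c 2 + G.law3 p a b c 3 :=
  c026_of_dFree_minors G a b c (fun u v _ => hG.dFreeIneq_minor a b c u v) p hp

/-- A marked multigraph that is acyclic or a hub-pair multigraph (every non-mark has at most one non-mark
neighbour). -/
def AcyclicOrHubPair {E : Type*} (G : MultiGraph V E) (a b c : V) : Prop :=
  G.Acyclic ∨ G.IsHubPairGraph a b c

/-- Both families are face-closed D-free. -/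
theorem AcyclicOrHubPair.dFreeIneq_minor {E : Type u} [Fintype E] [DecidableEq E] {G : MultiGraph V E}
    {a b c : V} (h : G.AcyclicOrHubPair a b c) (u v : Config E) :
    (G.minor u v).DFreeIneq (G.sureClass v a) (G.sureClass v b) (G.sureClass v c) := by
  classical
  rcases h with hA | hH
  · exact hA.dFreeIneq_minor a b c u v
  · by_cases hm : G.sureClass v a = G.sureClass v b ∨ G.sureClass v a = G.sureClass v c ∨
        G.sureClass v b = G.sureClass v c
    · exact dFreeIneq_of_marks_eq _ hm
    · exact dFreeIneq_of_hubPair (G.minor u v) (hH.minor u v) (fun h1 => hm (Or.inl h1))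
        (fun h2 => hm (Or.inr (Or.inl h2))) (fun h3 => hm (Or.inr (Or.inr h3)))

/-- **COROLLARY — tree-or-hub-pair bridges**: C-026 holds at every `p` on a marked multigraph whose
edges are coloured with every non-mark one-coloured (`IsGluingN`) and every colour class acyclic or
hub-pair. -/
theorem c026_of_acyclicOrHubPair_bridges {E : Type u} [Fintype E] [DecidableEq E] {ι : Type*} [Fintype ι]
    [DecidableEq ι] (G : MultiGraph V E) (a b c : V) (col : E → ι) (hg : G.IsGluingN a b c col)
    (h : ∀ i, (G.colPart col i).AcyclicOrHubPair a b c) (p : E → ℝ) (hp : IsProb p) :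
    (G.law3 p a b c 0 + G.law3 p a b c 1) * (G.law3 p a b c 1 + G.law3 p a b c 4) ≤
      G.law3 p a b c 1 + G.law3 p a b c 2 + G.law3 p a b c 3 :=
  G.c026_of_gluingN_of_dFree_minors a b c col hg (fun i u v _ => (h i).dFreeIneq_minor u v) p hp

/-- The corollary with `n` colour classes. -/
theorem c026_of_acyclicOrHubPair_bridgesFin {E : Type u} [Fintype E] [DecidableEq E] (n : ℕ)
    (G : MultiGraph V E) (a b c : V) (col : E → Fin n) (hg : G.IsGluingN a b c col)
    (h : ∀ i, (G.colPart col i).AcyclicOrHubPair a b c) (p : E → ℝ) (hp : IsProb p) :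
    (G.law3 p a b c 0 + G.law3 p a b c 1) * (G.law3 p a b c 1 + G.law3 p a b c 4) ≤
      G.law3 p a b c 1 + G.law3 p a b c 2 + G.law3 p a b c 3 :=
  c026_of_acyclicOrHubPair_bridges G a b c col hg h p hp

/-- **The side-by-side form**: a family of marked multigraphs on the same vertices sharing only the marks,
each acyclic or hub-pair, satisfies C-026 at every `p` on its union `sigmaGraph`. -/
theorem c026_of_acyclicOrHubPair_sigma {ι : Type*} [Fintype ι] [DecidableEq ι] {E : ι → Type u}
    [∀ i, Fintype (E i)] [∀ i, DecidableEq (E i)] (G : ∀ i, MultiGraph V (E i)) (a b c : V)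
    (hshare : SharesOnlyMarks G a b c) (h : ∀ i, (G i).AcyclicOrHubPair a b c)
    (p : (Σ i, E i) → ℝ) (hp : IsProb p) :
    ((sigmaGraph G).law3 p a b c 0 + (sigmaGraph G).law3 p a b c 1) *
        ((sigmaGraph G).law3 p a b c 1 + (sigmaGraph G).law3 p a b c 4) ≤
      (sigmaGraph G).law3 p a b c 1 + (sigmaGraph G).law3 p a b c 2 + (sigmaGraph G).law3 p a b c 3 :=
  (sigmaGraph G).c026_of_gluingN_of_dFree_minors a b c Sigma.fst (isGluingN_sigma hshare)
    (fun i u v _ => dFreeIneq_minor_edgeEquiv (ε := (sigmaColEquiv i).symm) (fun _ => rfl)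
      (fun _ => rfl) u v a b c ((h i).dFreeIneq_minor _ _)) p hp

end MultiGraph

end PercRepro
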